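import Summits.ResolutionOfSingularities.ResolutionOfSingularities.Theorems.MarkedTransferCampaignW46TameRidgeIdeal
import HarnessLib

/-!
# [OURS · L1 W4.6, rung (iv) «large characteristic»] Giraud's «the ridge ideal is generated by additive forms» holds
# for the cone of a TAME form — the named fact `RidgeIdealSpanAdditive p (h)` in the range `deg h < p` (there the
# additive generators are LINEAR)
# (cell res-hironaka, LADDER-RESOLUTION rung L, D-0089; slot W4.6, seat res-L1-s46-pv-7; host route MarkedTransfer,
# `--supports stmt-ResolutionOfSingularities-16155 --as helper`)

HONEST FRAMING. Nothing here is a statement of H. Hironaka's manuscript (2017-03-23, [Hironaka2017]) and nothing here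
asserts that any statement of it holds. The tree's `PointBlowupRidge.lean` records Giraud's structure theorem as the NAMED
FACT `RidgeIdealSpanAdditive p I : Prop := ridgeIdeal I = Ideal.span (Set.range (ridgeForm p I))` («𝔉 = ⟨θ : θ additive
homogeneous, θ ∈ 𝔉⟩»; «Not proved in the tree»). This file proves its INSTANCE for the principal ideal of a tame form —
a PARTIAL discharge, stated as such: by `TameRidgeIdeal` (p486683) the ridge ideal of `(h)` is generated by the LINEAR
Hasse–Schmidt coefficients, and linear forms `Σ_k c_k X_k = Σ_k c_k X_k^{p^0}` are additive forms of exponent `p^0`.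
No premise of the manuscript, no FACT-LIST premise. AI review is weaker than expert review. No `sorry`, no definition;
axioms standard.

* `ridgeIdealSpanAdditive_span_singleton_of_tame` — `RidgeIdealSpanAdditive p (Ideal.span {h})` for every form `h` of
  degree `d` with `1, …, d` non-zero in `K` and EVERY exponent base `p` (the additive generators found have exponent
  `p^0 = 1`);
* `ridgeIdealSpanAdditive_span_singleton_of_lt_char` — in characteristic `p`, for every form of degree `< p`.

For `deg h ≥ p` (the barrier regime: Hironaka's quadric, `Y_0^p`, …) the generators have higher `p`-power exponents and the
fact is Giraud's theorem proper — NOT proved here.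

## References (context; nothing is cited as a premise)

* J. Giraud, Ann. Sci. ÉNS 8 (1975) §1.5 («`F` admet pour équations des polynômes additifs»). [cite: Giraud1975, §1.5]
* Berthomieu–Hivert–Mourtada 2010, Lemma 2.6/2.7, Lemma 3.6. [cite: BerthomieuHivertMourtada2010, Lemma 2.7 and Lemma 3.6]
-/

noncomputable section

set_option linter.dupNamespace false -- mandated namespace of this single-conjunct summit

namespace Summit.ResolutionOfSingularities.ResolutionOfSingularities.Theorems
namespace CampaignW46
namespace TameRidgeAdditive

open MvPolynomial
open Literature.AlgebraicGeometry.Resolution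

universe u

variable {K : Type u} [Field K] {n : ℕ}

/-- A linear form lying in the ridge ideal is one of the tree's `ridgeForm`s (exponent `p^0`). [folklore] -/
theorem mem_range_ridgeForm_of_isHomogeneous_one (p : ℕ) {I : Ideal (MvPolynomial (Fin n) K)}
    {g : MvPolynomial (Fin n) K} (hg : g.IsHomogeneous 1) (hgI : g ∈ ridgeIdeal I) :
    g ∈ Set.range (ridgeForm p I) := by
  have hmem : g ∈ Submodule.span K (Set.range (X : Fin n → MvPolynomial (Fin n) K)) := by
    rw [← homogeneousSubmodule_one_eq_span_X]
    exact hg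
  obtain ⟨c, hc⟩ := (Submodule.mem_span_range_iff_exists_fun K).mp hmem
  have hsum : (∑ k, C (c k) * X k ^ p ^ 0 : MvPolynomial (Fin n) K) = g := by
    rw [← hc]
    exact Finset.sum_congr rfl fun k _ => by rw [pow_zero, pow_one, smul_eq_C_mul]
  exact ⟨⟨(c, 0), by rw [hsum]; exact hgI⟩, hsum⟩

/-- [OURS · L1 W4.6 (iv); NOT a statement of the manuscript] **Giraud's generation statement for the cone of a tame
form.** For a form `h` of degree `d` over `K` with `1, …, d` non-zero in `K`, and every exponent base `p`, the ridge
ideal of `(h)` is generated by the additive homogeneous forms it contains — the tree's named fact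
`RidgeIdealSpanAdditive p (Ideal.span {h})` (PARTIAL discharge: the tame principal case; the generators are linear).
[folklore] -/
theorem ridgeIdealSpanAdditive_span_singleton_of_tame (p : ℕ) {h : MvPolynomial (Fin n) K} {d : ℕ}
    (hh : h.IsHomogeneous d) (hchar : ∀ m : ℕ, 1 ≤ m → m ≤ d → (m : K) ≠ 0) :
    RidgeIdealSpanAdditive p (Ideal.span {h}) := by
  unfold RidgeIdealSpanAdditive
  refine le_antisymm ?_ (Ideal.span_le.mpr (range_ridgeForm_subset p _))
  have hlin := TameRidgeIdeal.ridgeIdeal_span_singleton_eq_span_linearHasse hh hchar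
  conv_lhs => rw [hlin]
  refine Ideal.span_mono fun g hg => ?_
  refine mem_range_ridgeForm_of_isHomogeneous_one p (TameRidgeIdeal.isHomogeneous_one_of_mem_linearHasse hh hg) ?_
  rw [hlin]
  exact Ideal.subset_span hg

/-- [OURS · L1 W4.6 (iv)] **Characteristic `p > deg h`**: `RidgeIdealSpanAdditive p (h)` for every form `h` of degree
`< p` — in regime (iv) Giraud's additive generators of the ridge ideal of a hypersurface cone are linear forms.
[folklore] -/
theorem ridgeIdealSpanAdditive_span_singleton_of_lt_char (p : ℕ) [CharP K p] {h : MvPolynomial (Fin n) K} {d : ℕ}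
    (hh : h.IsHomogeneous d) (hd : d < p) : RidgeIdealSpanAdditive p (Ideal.span {h}) :=
  ridgeIdealSpanAdditive_span_singleton_of_tame p hh (TamePolar.natCast_ne_zero_of_lt_char p hd)

/-- [OURS · L1 W4.6 (iv)] **Characteristic `0`**: `RidgeIdealSpanAdditive p (h)` for every form `h` and every `p`.
[folklore] -/
theorem ridgeIdealSpanAdditive_span_singleton_of_charZero [CharZero K] (p : ℕ) {h : MvPolynomial (Fin n) K} {d : ℕ}
    (hh : h.IsHomogeneous d) : RidgeIdealSpanAdditive p (Ideal.span {h}) :=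
  ridgeIdealSpanAdditive_span_singleton_of_tame p hh (TamePolar.natCast_ne_zero_of_charZero d)

end TameRidgeAdditive
end CampaignW46
end Summit.ResolutionOfSingularities.ResolutionOfSingularities.Theorems

end
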